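import Summits.BirchSwinnertonDyer.BirchSwinnertonDyer.Theorems.ManinLocalTwoThreeBlindNoDoubling
import Summits.BirchSwinnertonDyer.BirchSwinnertonDyer.Theorems.ManinLocalTwoThreeHalfLatticeVeluAnyModel
import Summits.BirchSwinnertonDyer.BirchSwinnertonDyer.Theorems.ManinLocalTwoThreeGammaOneIndexFour
import Literature.NumberTheory.EllipticCurves.ManinConstantGamma1Gamma0LedgerProofs
import HarnessLib

/-!
# No doubling ⟹ the Shimura-kernel generator is Kummer-BLIND (the converse Vélu step of the Γ₀/Γ₁ ledger at `2`)

Summit `BirchSwinnertonDyer`, route `ManinLocalTwoThree` (cell bsd-f2-manin), crux C2 `ManinOddAtFour` (stmt-BirchSwinnertonDyer-22967);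
lead p1 gen 18, LEAD-MEMO v37 §3 («the line has converged»).

For the optimal `X₁(N)`/`X₀(N)` pair `(D₁, D₀)` of a class with `4 ∣ N` (globally minimal `W₁`, `W₀ = [0, a₂, 0, a₄, a₆]`) the tree's ledger
gives `|c₀| ∈ {|c₁|, 2|c₁|}` and `2 ∤ c₀ ⟺ (2 ∤ c₁ ∧ |c₀| = |c₁|)`; `…BlindNoDoubling` proved «all rational 2-torsion blind ∧ doubled ⟹
index 4».  Here the CONVERSE direction, which makes the v27 law E-an-152♭|_G («a blind rational `2`-division root exists on the gain locus»)
provably EQUIVALENT to the no-doubling bit of C2 on index-`2` classes: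

* `kummerBlindAtTwo_of_velu_half` — pure `2`-adic algebra: if an INTEGRAL Weierstrass model `I/ℤ` has the invariants of the `u = 2`
  rescaling of Vélu's model of `W₀/⟨(e,0)⟩` (`c₄(I) = A² + 12B`, `c₆(I) = −A³ + 36AB`, `A = a₂ + 3e`, `B = 3e² + 2a₂e + a₄`) and `W₀` is
  globally minimal, then `(e, 0)` is Kummer-blind (`2 ∣ A ∧ 16 ∣ A² − 4B`).  [`a₁(I)` even ⟹ `16 ∣ c₄(I)` (tree `ThetaPartnerXRoute.sixteen_dvd_c₄_of_even_a₁`, re-derived inline) ⟹ blind; `a₁(I)` odd ⟹ `c₄(I)` odd,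
  `c₆(I) ≡ 3 (mod 4)`, `16Δ(I) = B(A² − 4B)²` ⟹ `A ≡ 1 (mod 4)`, `16 ∣ B` ⟹ `x = 4X + e, y = 8Y + 4X` makes `W₀` non-minimal at `2`.]
* `velu_half_of_natAbs_eq_of_ne` — lattice side: `|c₀| = |c₁|` and `Λ₁(f) ≠ Λ₀(f)` at `4 ∣ N` ⟹ `Λ_{E₀} ⊊ ½Λ_{E₁}`-configuration of index `2`,
  hence (Vélu rigidity `velu_two_rigidity` applied to `L' = ½Λ_{E₁}`) a rational `2`-torsion point `T = (q − b₂/12, 0)` of `W₀` with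
  `16·c₄(W₁) = 720q² − 4c₄(W₀)`, `64·c₆(W₁) = 19008q³ − 144c₄(W₀)q` (index `4` being excluded by `|c₀| = 2|c₁|` there, E-an-68).
* `exists_kummerBlind_root_of_natAbs_eq_of_ne` — **for the optimal pair of a class with `4 ∣ N`, `W₀ = [0,a₂,0,a₄,a₆]`: `|c₀| = |c₁|` and
  `Λ₁(f) ≠ Λ₀(f)` ⟹ `W₀` has a Kummer-BLIND integral `2`-division root** (the generator of `ker(E₀ → E₁)`); with E-an-71 (`atMostOneBlindRoot`) it is
  the unique blind root.  Contrapositive (`natAbs_eq_two_mul_of_noBlindRoot_of_ne`): on an index-`2` class with NO blind rational root the pair is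
  DOUBLED, `|c₀| = 2|c₁|`, so `2 ∣ c₀` — i.e. C2 FAILS there; hence C2 ⟹ E-an-152♭ on {Λ₁ ≠ Λ₀}, and the law is NECESSARY, not a convenience.

HONEST FRAMING: structure only (which bad world C2 forbids); no Manin constant's parity is decided; C2, Manin's conjecture and BSD are NOT proved.
No definitions, no sorry. [cite: Stevens1989, §2] [cite: SilvermanAEC2009, VII.1 and VIII.8] [cite: Kraus1989, Prop. 2]
-/

set_option autoImplicit false
-- the summit-side namespace `Summit.BirchSwinnertonDyer.BirchSwinnertonDyer.…` is the tree's (summit = sub-problem)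
set_option linter.dupNamespace false

noncomputable section

open WeierstrassCurve Literature.NumberTheory.EllipticCurves Literature.NumberTheory.EllipticCurves.ModularForms
open CongruenceSubgroup
open Summit.BirchSwinnertonDyer.Rank1Residual.ManinAdditive.ShimuraLedger
open Summit.BirchSwinnertonDyer.Rank1Residual.ManinAdditive.CuspidalKummer

namespace Summit.BirchSwinnertonDyer.BirchSwinnertonDyer.Theorems.ManinLocalTwoThree

/-! ## §1 Parity bookkeeping for an integral Weierstrass model over `ℤ` -/

/-- An integral model with ODD `a₁` has ODD `c₄`. [folklore] -/
theorem odd_c₄_of_odd_a₁ (I : WeierstrassCurve ℤ) (h : Odd I.a₁) : Odd I.c₄ := by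
  obtain ⟨k, hk⟩ := h
  refine ⟨8 * (k ^ 2 + k + I.a₂) ^ 2 + 4 * (k ^ 2 + k + I.a₂) - 12 * ((2 * k + 1) * I.a₃ + 2 * I.a₄), ?_⟩
  simp only [WeierstrassCurve.c₄, WeierstrassCurve.b₂, WeierstrassCurve.b₄, hk]
  ring

/-- An integral model with ODD `a₁` has `c₆ ≡ 3 (mod 4)` (`c₆ ≡ −b₂³`, `b₂ ≡ 1 (mod 4)`). [folklore] -/
theorem c₆_eq_four_mul_add_three_of_odd_a₁ (I : WeierstrassCurve ℤ) (h : Odd I.a₁) : ∃ m : ℤ, I.c₆ = 4 * m + 3 := by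
  obtain ⟨k, hk⟩ := h
  refine ⟨-(16 * (k ^ 2 + k + I.a₂) ^ 3 + 12 * (k ^ 2 + k + I.a₂) ^ 2 + 3 * (k ^ 2 + k + I.a₂)) - 1 +
    9 * (4 * (k ^ 2 + k + I.a₂) + 1) * ((2 * k + 1) * I.a₃ + 2 * I.a₄) - 54 * (I.a₃ ^ 2 + 4 * I.a₆), ?_⟩
  simp only [WeierstrassCurve.c₆, WeierstrassCurve.b₂, WeierstrassCurve.b₄, WeierstrassCurve.b₆, hk]
  ring

/-- `16 ∣ B·D²` with `D` odd forces `16 ∣ B`. [folklore] -/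
theorem sixteen_dvd_of_sixteen_dvd_mul_sq_odd {B D : ℤ} (hD : Odd D) (h : (16 : ℤ) ∣ B * D ^ 2) : (16 : ℤ) ∣ B := by
  have hcop : IsCoprime (2 : ℤ) D := Int.isCoprime_two_left.mpr hD
  have h16 : IsCoprime ((2 : ℤ) ^ 4) (D ^ 2) := hcop.pow
  exact (show (16 : ℤ) = 2 ^ 4 by norm_num) ▸ h16.dvd_of_dvd_mul_right ((show (16 : ℤ) = 2 ^ 4 by norm_num) ▸ h)

/-! ## §2 The `2`-adic algebra: `u = 2` Vélu invariants on an integral model force blindness -/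

/-- **Kummer-blindness from the halved Vélu invariants.**  `W₀ = [0, a₂, 0, a₄, a₆]` globally minimal with integer coefficients `A₂, A₄, A₆`,
`e` an integral root of the `2`-division cubic, `A = A₂ + 3e`, `B = 3e² + 2A₂e + A₄`; if some integral model `I/ℤ` has `c₄(I) = A² + 12B` and
`c₆(I) = −A³ + 36AB` (the invariants of the `u = 2` rescaling of Vélu's model `[0, −2A, 0, A² − 4B, 0]` of `W₀/⟨(e,0)⟩`), then `(e, 0)` is
Kummer-blind at `2`. [cite: SilvermanAEC2009, VII.1 and VIII.8] [cite: Kraus1989, Prop. 2] -/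
theorem kummerBlindAtTwo_of_velu_half (W : WeierstrassCurve ℚ) [W.IsElliptic] [W.IsGloballyMinimal]
    (ha₁ : W.a₁ = 0) (ha₃ : W.a₃ = 0) (A₂ A₄ A₆ e : ℤ) (hA₂ : (A₂ : ℚ) = W.a₂) (hA₄ : (A₄ : ℚ) = W.a₄)
    (hA₆ : (A₆ : ℚ) = W.a₆) (he : e ^ 3 + A₂ * e ^ 2 + A₄ * e + A₆ = 0) (I : WeierstrassCurve ℤ)
    (hc₄ : I.c₄ = (A₂ + 3 * e) ^ 2 + 12 * (3 * e ^ 2 + 2 * A₂ * e + A₄))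
    (hc₆ : I.c₆ = -(A₂ + 3 * e) ^ 3 + 36 * (A₂ + 3 * e) * (3 * e ^ 2 + 2 * A₂ * e + A₄)) :
    KummerBlindAtTwo A₂ A₄ e := by
  set A : ℤ := A₂ + 3 * e with hA
  set B : ℤ := 3 * e ^ 2 + 2 * A₂ * e + A₄ with hB
  -- the target in terms of `A, B`
  have key : (A₂ + e) ^ 2 - 4 * (A₄ + (A₂ + e) * e) = A ^ 2 - 4 * B := by rw [hA, hB]; ring
  rcases Int.even_or_odd I.a₁ with hev | hodd
  · -- `a₁(I)` even: `16 ∣ c₄(I) = A² + 12B`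
    obtain ⟨t, ht⟩ : (16 : ℤ) ∣ A ^ 2 + 12 * B := by
      -- an integral model with even `a₁` has `16 ∣ c₄` (`b₂ ≡ 0 (4)`, `2 ∣ b₄`)
      obtain ⟨k, hk⟩ := hev
      refine ⟨(k ^ 2 + I.a₂) ^ 2 - 3 * (k * I.a₃ + I.a₄), ?_⟩
      rw [← hc₄]
      simp only [WeierstrassCurve.c₄, WeierstrassCurve.b₂, WeierstrassCurve.b₄, hk]
      ring
    have hAev : Even A := by
      by_contra hA'
      obtain ⟨a, ha⟩ := Int.not_even_iff_odd.mp hA'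
      have h1 : (2 * a + 1) ^ 2 + 12 * B = 16 * t := by rw [← ha]; exact ht
      have h2 : 4 * (a ^ 2 + a) + 1 + 12 * B = 16 * t := by linear_combination h1
      generalize a ^ 2 + a = P at h2
      omega
    obtain ⟨a, ha⟩ := hAev
    have h1 : 4 * (a * a) + 12 * B = 16 * t := by rw [← ht, ha]; ring
    refine ⟨⟨a - e, by linear_combination ha - hA⟩, ?_⟩
    rw [key]
    exact ⟨t - B, by linear_combination (A + a + a) * ha + h1⟩
  · -- `a₁(I)` odd: `A ≡ 1 (mod 4)` and `16 ∣ B`, then `W` is not minimal at `2` — contradiction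
    exfalso
    have hc₄odd : Odd (A ^ 2 + 12 * B) := hc₄ ▸ odd_c₄_of_odd_a₁ I hodd
    have hAodd : Odd A := by
      by_contra hA'
      obtain ⟨a, ha⟩ := Int.not_odd_iff_even.mp hA'
      exact Int.not_even_iff_odd.mpr hc₄odd ⟨2 * a * a + 6 * B, by rw [ha]; ring⟩
    obtain ⟨a, ha⟩ := hAodd
    obtain ⟨m, hm⟩ := c₆_eq_four_mul_add_three_of_odd_a₁ I hodd
    rw [hc₆] at hm
    -- `A ≡ 1 (mod 4)`: `−A³ + 36AB ≡ −A ≡ 3 (mod 4)`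
    have h4a : (2 : ℤ) ∣ a := by
      have h1 : -(2 * a + 1) ^ 3 + 36 * (2 * a + 1) * B = 4 * m + 3 := by rw [← ha]; exact hm
      have h2 : 6 * a + 4 = 4 * (-(2 * a ^ 3) - 3 * a ^ 2 + 9 * (2 * a + 1) * B - m) := by
        linear_combination (-1 : ℤ) * h1
      generalize -(2 * a ^ 3) - 3 * a ^ 2 + 9 * (2 * a + 1) * B - m = P at h2
      omega
    obtain ⟨a', ha'⟩ := h4a
    -- `16 ∣ B`: `16Δ(I) = B(A² − 4B)²` with `A² − 4B` odd
    have hΔ : 16 * I.Δ = B * (A ^ 2 - 4 * B) ^ 2 := by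
      have hrel := I.c_relation
      rw [hc₄, hc₆] at hrel
      have h108 : (108 : ℤ) * (16 * I.Δ) = 108 * (B * (A ^ 2 - 4 * B) ^ 2) := by linear_combination hrel
      exact mul_left_cancel₀ (by norm_num : (108 : ℤ) ≠ 0) h108
    have hDodd : Odd (A ^ 2 - 4 * B) := ⟨2 * a ^ 2 + 2 * a - 2 * B, by linear_combination (A + 2 * a + 1) * ha⟩
    have h16B : (16 : ℤ) ∣ B := sixteen_dvd_of_sixteen_dvd_mul_sq_odd hDodd ⟨I.Δ, hΔ.symm⟩
    obtain ⟨k₄, hk₄⟩ := h16B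
    -- the rescaled model `x = 4X + e`, `y = 8Y + 4X` (`C = (2; e, 1, 0)`): `[1, (A − 1)/4, 0, B/16, 0]`
    have hk₂ : A₂ + 3 * e - 1 = 4 * a' := by rw [← hA, ha, ha']; ring
    set C : VariableChange ℚ := ⟨Units.mk0 (2 : ℚ) two_ne_zero, (e : ℚ), 1, 0⟩ with hC
    have hu : ((C.u⁻¹ : ℚˣ) : ℚ) = (2 : ℚ)⁻¹ := by rw [Units.val_inv_eq_inv_val, hC, Units.val_mk0]
    have h₁ : (C • W).a₁ = ((1 : ℤ) : ℚ) := by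
      rw [variableChange_a₁, ha₁, hu]; simp [hC]
    have h₂ : (C • W).a₂ = ((a' : ℤ) : ℚ) := by
      rw [variableChange_a₂, ha₁, ← hA₂, hu]
      have : (A₂ : ℚ) + 3 * e - 1 = 4 * a' := by exact_mod_cast hk₂
      simp only [hC]
      linear_combination (1 / 4 : ℚ) * this
    have h₃ : (C • W).a₃ = ((0 : ℤ) : ℚ) := by
      rw [variableChange_a₃, ha₁, ha₃]; simp [hC]
    have h₄ : (C • W).a₄ = ((k₄ : ℤ) : ℚ) := by
      rw [variableChange_a₄, ha₁, ha₃, ← hA₂, ← hA₄, hu]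
      have : (3 : ℚ) * e ^ 2 + 2 * A₂ * e + A₄ = 16 * k₄ := by exact_mod_cast (hB ▸ hk₄ : 3 * e ^ 2 + 2 * A₂ * e + A₄ = 16 * k₄)
      simp only [hC]
      linear_combination (1 / 16 : ℚ) * this
    have h₆ : (C • W).a₆ = ((0 : ℤ) : ℚ) := by
      rw [variableChange_a₆, ha₁, ha₃, ← hA₂, ← hA₄, ← hA₆, hu]
      have : (e : ℚ) ^ 3 + A₂ * e ^ 2 + A₄ * e + A₆ = 0 := by exact_mod_cast he
      simp only [hC]
      linear_combination (1 / 64 : ℚ) * this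
    haveI : Fact (Nat.Prime 2) := ⟨Nat.prime_two⟩
    have hle := padicValInt_minimalDiscriminantInt_le_padicValRat_Δ_smul W C 1 a' 0 k₄ 0 h₁ h₂ h₃ h₄ h₆ 2
    have hΔ' : (C • W).Δ = (2 : ℚ)⁻¹ ^ 12 * (W.minimalDiscriminantInt : ℚ) := by
      rw [variableChange_Δ, hu, cast_minimalDiscriminantInt]
    have hm0 : (W.minimalDiscriminantInt : ℚ) ≠ 0 := by exact_mod_cast minimalDiscriminantInt_ne_zero W
    rw [hΔ', padicValRat.mul (pow_ne_zero _ (inv_ne_zero two_ne_zero)) hm0, padicValRat.pow,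
      padicValRat.inv, padicValRat.of_int] at hle
    have h2 : padicValRat 2 (2 : ℚ) = 1 := by exact_mod_cast padicValRat.self (p := 2) one_lt_two
    rw [h2] at hle
    push_cast at hle
    linarith

/-! ## §3 The lattice side: no doubling and `Λ₁ ≠ Λ₀` put `½Λ_{E₁}` in the index-`2` position over `Λ_{E₀}` -/

variable {W₁ W₀ : WeierstrassCurve ℚ} [W₁.IsElliptic] [W₁.IsGloballyMinimal] [W₀.IsElliptic]
  [W₀.IsGloballyMinimal] {N : ℕ} [NeZero N]

/-- **No doubling ∧ `Λ₁(f) ≠ Λ₀(f)` ⟹ halved Vélu rigidity (any model).**  For the optimal `X₁(N)`-datum `D₁` and a lattice-optimal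
`X₀(N)`-datum `D₀` of a class at `4 ∣ N` with `|c₀| = |c₁|` and `Λ₁(f) ≠ Λ₀(f)`: there is `q ∈ ℚ` with `W₀.Ψ₂Sq(q − b₂/12) = 0` (a rational
`2`-torsion point `T`, the generator of `ker(E₀ → E₁)`) such that `16·c₄(W₁) = 720q² − 4c₄(W₀)` and `64·c₆(W₁) = 19008q³ − 144c₄(W₀)q` — the
globally minimal `W₁` carries the invariants of the `u = 2` RESCALED Vélu model of `E₀/⟨T⟩`.  (`Λ_{E₀} ⊆ ½Λ_{E₁} ⊆ ½Λ_{E₀}`; of the three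
positions, `½Λ_{E₁} = Λ_{E₀}` is index `4`, excluded by E-an-68 `|c₀| = 2|c₁|`, and `½Λ_{E₁} = ½Λ_{E₀}` is `Λ₁ = Λ₀`.) [cite: Stevens1989, §2] -/
theorem velu_half_of_natAbs_eq_of_ne (D₁ : Gamma1ParametrizationData W₁ N) (D₀ : ModularParametrizationData W₀ N)
    (hiso : IsIsogenous W₁ W₀) (h₁ : D₁.IsOptimal) (h₀ : ∀ z ∈ D₀.L.lattice, ∃ w ∈ periodLattice D₀.f, z = D₀.c * w)
    (h4 : 2 ^ 2 ∣ N) (heq : D₀.maninConstant.natAbs = D₁.maninConstant.natAbs)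
    (hne : periodLatticeGamma1 D₀.f ≠ periodLattice D₀.f) :
    ∃ q : ℚ, W₀.Ψ₂Sq.eval (q - W₀.b₂ / 12) = 0 ∧ 16 * W₁.c₄ = 720 * q ^ 2 - 4 * W₀.c₄ ∧
      64 * W₁.c₆ = 19008 * q ^ 3 - 144 * W₀.c₄ * q := by
  have hf : D₁.f = D₀.f := D₁.f_eq_of_isIsogenous D₀ hiso
  have hc₁ : (D₁.c : ℂ) ≠ 0 := by exact_mod_cast D₁.maninConstant_ne_zero
  -- `c₀ = ε c₁`, `ε = ±1`
  obtain ⟨ε, hε, hcc⟩ : ∃ ε : ℂ, (ε = 1 ∨ ε = -1) ∧ (D₀.c : ℂ) = ε * D₁.c := by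
    rcases Int.natAbs_eq_natAbs_iff.mp heq with h' | h'
    · exact ⟨1, Or.inl rfl, by rw [one_mul]; exact_mod_cast h'⟩
    · exact ⟨-1, Or.inr rfl, by rw [neg_one_mul]; exact_mod_cast h'⟩
  have hε2 : ε * ε = 1 := by rcases hε with rfl | rfl <;> norm_num
  have hεmem : ∀ (S : AddSubgroup ℂ) (w : ℂ), w ∈ S → ε * w ∈ S := by
    intro S w hw; rcases hε with rfl | rfl
    · rwa [one_mul]
    · rw [neg_one_mul]; exact neg_mem hw
  -- Ling–Oesterlé at the traceless prime `2`: `2Λ₀ ⊆ Λ₁`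
  have h2Λ : ∀ w ∈ periodLattice D₀.f, (2 : ℂ) * w ∈ periodLatticeGamma1 D₀.f := fun w hw ↦ by
    have h := pMulLatticeLeGamma1OfTracelessPrime_holds N D₀.f D₀.isNewformOf.1 2 Nat.prime_two
      ((dvd_pow_self 2 two_ne_zero).trans h4) (D₀.isNewformOf.1.cuspCoeff_eq_zero_of_sq_dvd Nat.prime_two h4) w hw
    exact_mod_cast h
  -- the half lattice `L' = ½Λ_{E₁}`
  set L' : PeriodPair := D₁.L.mulLeft (2 : ℂ)⁻¹ (inv_ne_zero two_ne_zero) with hL'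
  have hmemL' : ∀ w : ℂ, w ∈ L'.lattice ↔ 2 * w ∈ D₁.L.lattice := by
    intro w; rw [hL', PeriodPair.mem_mulLeft_lattice, inv_inv]
  have hle : D₀.L.lattice ≤ L'.lattice := by
    intro z hz
    obtain ⟨w, hw, rfl⟩ := h₀ z hz
    rw [hmemL']
    have e : 2 * ((D₀.c : ℂ) * w) = (D₁.c : ℂ) * (ε * (2 * w)) := by rw [hcc]; ring
    rw [e]
    exact D₁.smul_periodLatticeGamma1_le _ (hεmem _ _ (by rw [hf]; exact h2Λ w hw))
  have htwo : ∀ w ∈ L'.lattice, 2 * w ∈ D₀.L.lattice := by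
    intro w hw
    rw [hmemL'] at hw
    obtain ⟨w₁, hw₁, hw₁'⟩ := h₁ _ hw
    have hw₀ : ε * w₁ ∈ periodLattice D₀.f := hεmem _ _ (hf ▸ periodLatticeGamma1_le_periodLattice D₁.f hw₁)
    have e : 2 * w = (D₀.c : ℂ) * (ε * w₁) := by
      rw [hw₁', hcc]; linear_combination -((D₁.c : ℂ) * w₁) * hε2
    rw [e]; exact D₀.smul_periodLattice_le _ hw₀
  rcases halfLattice_trichotomy D₀.L L' hle htwo with hcase | hcase | hcase
  · -- `½Λ_{E₁} = Λ_{E₀}`: index 4, so `|c₀| = 2|c₁|` — contradicting `|c₀| = |c₁| ≠ 0`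
    exfalso
    have hidx : ∀ z : ℂ, z ∈ periodLatticeGamma1 D₁.f ↔ ∃ w ∈ periodLattice D₀.f, z = 2 * w := by
      intro z
      constructor
      · intro hz
        have hz1 : (D₁.c : ℂ) * z ∈ D₁.L.lattice := D₁.smul_periodLatticeGamma1_le z hz
        have hw' : (D₁.c : ℂ) * z / 2 ∈ L'.lattice := by
          rw [hmemL']
          have e : 2 * ((D₁.c : ℂ) * z / 2) = (D₁.c : ℂ) * z := by ring
          rw [e]; exact hz1
        obtain ⟨w, hw, hw''⟩ := h₀ _ (hcase _ hw')
        refine ⟨ε * w, hεmem _ _ hw, ?_⟩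
        have h : (D₁.c : ℂ) * z = (D₁.c : ℂ) * (2 * (ε * w)) := by
          rw [hcc] at hw''; linear_combination 2 * hw''
        exact mul_left_cancel₀ hc₁ h
      · rintro ⟨w, hw, rfl⟩
        rw [hf]; exact h2Λ w hw
    have h2x := natAbs_maninConstant₀_eq_two_mul_of_index_four D₁ D₀ h₁ h₀ hidx
    have hne0 : D₁.maninConstant.natAbs ≠ 0 := Int.natAbs_ne_zero.mpr D₁.maninConstant_ne_zero
    omega
  · -- `½Λ_{E₀} ⊆ ½Λ_{E₁}`: `Λ₁ = Λ₀`, contradicting `hne`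
    exfalso
    apply hne
    refine le_antisymm (periodLatticeGamma1_le_periodLattice D₀.f) fun w hw ↦ ?_
    have h2h : 2 * ((D₀.c : ℂ) * w / 2) ∈ D₀.L.lattice := by
      have e : 2 * ((D₀.c : ℂ) * w / 2) = (D₀.c : ℂ) * w := by ring
      rw [e]; exact D₀.smul_periodLattice_le w hw
    have hL := hcase _ h2h
    rw [hmemL'] at hL
    have e : 2 * ((D₀.c : ℂ) * w / 2) = (D₀.c : ℂ) * w := by ring
    rw [e] at hL
    obtain ⟨w₁, hw₁, hw₁'⟩ := h₁ _ hL
    have hw' : w = ε * w₁ := by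
      have h : (D₁.c : ℂ) * w = (D₁.c : ℂ) * (ε * w₁) := by
        rw [hcc] at hw₁'
        linear_combination ε * hw₁' - (D₁.c : ℂ) * w * hε2
      exact mul_left_cancel₀ hc₁ h
    rw [hw', ← hf]; exact hεmem _ _ hw₁
  · -- index 2: Vélu rigidity for `L' = ½Λ_{E₁}`, whose invariants are `16·c₄(W₁)/12`, `64·c₆(W₁)/216`
    obtain ⟨z₀, hz₀', hz₀, hidx⟩ := hcase
    have hc₄W₁ : (W₁.baseChange ℂ).c₄ = (W₁.c₄ : ℂ) := by simp [WeierstrassCurve.baseChange, WeierstrassCurve.map_c₄]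
    have hc₆W₁ : (W₁.baseChange ℂ).c₆ = (W₁.c₆ : ℂ) := by simp [WeierstrassCurve.baseChange, WeierstrassCurve.map_c₆]
    have hA : ((16 * W₁.c₄ / 12 : ℚ) : ℂ) = L'.g₂ := by
      rw [hL', PeriodPair.g₂_mulLeft, D₁.isNeronLattice.1, hc₄W₁]; push_cast; ring
    have hB : ((64 * W₁.c₆ / 216 : ℚ) : ℂ) = L'.g₃ := by
      rw [hL', PeriodPair.g₃_mulLeft, D₁.isNeronLattice.2, hc₆W₁]; push_cast; ring
    obtain ⟨q, -, hroot, hA', hB'⟩ := velu_two_rigidity D₀.isNeronLattice L' hA hB hle hz₀' hz₀ (htwo z₀ hz₀') hidx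
    exact ⟨q, hroot, by linear_combination 12 * hA', by linear_combination 216 * hB'⟩

/-! ## §4 No doubling ⟹ a BLIND rational `2`-division root; contrapositive: no blind root ⟹ doubled, `2 ∣ c₀` -/

/-- Rational root theorem, monic cubic over `ℤ`. [folklore] -/
theorem exists_int_cast_eq_of_monic_cubic (x : ℚ) (a b c : ℤ) (h : x ^ 3 + a * x ^ 2 + b * x + c = 0) :
    ∃ n : ℤ, (n : ℚ) = x := by
  open Polynomial in
  obtain ⟨n, hn, -⟩ := exists_integer_of_is_root_of_monic
    (p := X ^ 3 + Polynomial.C a * X ^ 2 + Polynomial.C b * X + Polynomial.C c) (by monicity!)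
    (r := x) (by simp [h])
  exact ⟨n, by simp [hn]⟩

/-- **NO DOUBLING ⟹ THE SHIMURA-KERNEL GENERATOR IS KUMMER-BLIND.**  For the optimal `X₁(N)`-datum `D₁` (globally minimal `W₁`) and a
lattice-optimal `X₀(N)`-datum `D₀` of a globally minimal `W₀ = [0, a₂, 0, a₄, a₆]` in one class, `4 ∣ N`: if `|c₀| = |c₁|` and
`Λ₁(f) ≠ Λ₀(f)`, then `W₀` has an integral `2`-division root `e` with `(e, 0)` Kummer-BLIND at `2`.  With E-an-71 (`atMostOneBlindRoot`) it is
the unique blind root; it generates `ker(E₀ → E₁)`.  So on index-`2` classes the v27 law E-an-152♭ («a blind rational root exists») FOLLOWS from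
the no-doubling bit of C2. [cite: Stevens1989, §2] [cite: SilvermanAEC2009, VII.1 and VIII.8] -/
theorem exists_kummerBlind_root_of_natAbs_eq_of_ne (D₁ : Gamma1ParametrizationData W₁ N)
    (D₀ : ModularParametrizationData W₀ N) (hiso : IsIsogenous W₁ W₀) (h₁ : D₁.IsOptimal)
    (h₀ : ∀ z ∈ D₀.L.lattice, ∃ w ∈ periodLattice D₀.f, z = D₀.c * w) (h4 : 2 ^ 2 ∣ N)
    (ha₁ : W₀.a₁ = 0) (ha₃ : W₀.a₃ = 0) (A₂ A₄ A₆ : ℤ) (hA₂ : (A₂ : ℚ) = W₀.a₂) (hA₄ : (A₄ : ℚ) = W₀.a₄)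
    (hA₆ : (A₆ : ℚ) = W₀.a₆) (heq : D₀.maninConstant.natAbs = D₁.maninConstant.natAbs)
    (hne : periodLatticeGamma1 D₀.f ≠ periodLattice D₀.f) :
    ∃ e : ℤ, e ^ 3 + A₂ * e ^ 2 + A₄ * e + A₆ = 0 ∧ KummerBlindAtTwo A₂ A₄ e := by
  obtain ⟨q, hroot, h4', h6'⟩ := velu_half_of_natAbs_eq_of_ne D₁ D₀ hiso h₁ h₀ h4 heq hne
  -- the rational root `x = q − b₂/12 = q − a₂/3` of the monic integral cubic is an integer `e`
  have hb₂ : W₀.b₂ = 4 * A₂ := by rw [WeierstrassCurve.b₂, ha₁, ← hA₂]; ring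
  have hx : (q - A₂ / 3 : ℚ) ^ 3 + A₂ * (q - A₂ / 3) ^ 2 + A₄ * (q - A₂ / 3) + A₆ = 0 := by
    have h := hroot
    simp only [WeierstrassCurve.Ψ₂Sq, WeierstrassCurve.b₂, WeierstrassCurve.b₄, WeierstrassCurve.b₆, ha₁, ha₃, ← hA₂,
      ← hA₄, ← hA₆, Polynomial.eval_add, Polynomial.eval_mul, Polynomial.eval_pow, Polynomial.eval_C,
      Polynomial.eval_X] at h
    linear_combination h / 4
  obtain ⟨e, he⟩ := exists_int_cast_eq_of_monic_cubic _ A₂ A₄ A₆ hx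
  have heZ : e ^ 3 + A₂ * e ^ 2 + A₄ * e + A₆ = 0 := by
    have h : ((e ^ 3 + A₂ * e ^ 2 + A₄ * e + A₆ : ℤ) : ℚ) = 0 := by push_cast; rw [he]; exact hx
    exact_mod_cast h
  have hq : q = (e : ℚ) + A₂ / 3 := by rw [he]; ring
  -- `c₄(W₀) = 16A₂² − 48A₄`; the halved Vélu invariants on the integral model of `W₁`
  have hc₄W₀ : W₀.c₄ = 16 * A₂ ^ 2 - 48 * A₄ := by
    rw [WeierstrassCurve.c₄, WeierstrassCurve.b₂, WeierstrassCurve.b₄, ha₁, ha₃, ← hA₂, ← hA₄]; ring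
  set I : WeierstrassCurve ℤ := WeierstrassCurve.integralModelInt W₁ with hI
  have hImap : I.map (Int.castRingHom ℚ) = W₁ := WeierstrassCurve.map_integralModelInt W₁
  have hIc₄ : ((I.c₄ : ℤ) : ℚ) = W₁.c₄ := by
    conv_rhs => rw [← hImap]
    simp [WeierstrassCurve.map_c₄]
  have hIc₆ : ((I.c₆ : ℤ) : ℚ) = W₁.c₆ := by
    conv_rhs => rw [← hImap]
    simp [WeierstrassCurve.map_c₆]
  have hc₄ : I.c₄ = (A₂ + 3 * e) ^ 2 + 12 * (3 * e ^ 2 + 2 * A₂ * e + A₄) := by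
    have h : ((I.c₄ : ℤ) : ℚ) = (((A₂ + 3 * e) ^ 2 + 12 * (3 * e ^ 2 + 2 * A₂ * e + A₄) : ℤ) : ℚ) := by
      rw [hIc₄]; push_cast
      rw [hq, hc₄W₀] at h4'
      linear_combination h4' / 16
    exact_mod_cast h
  have hc₆ : I.c₆ = -(A₂ + 3 * e) ^ 3 + 36 * (A₂ + 3 * e) * (3 * e ^ 2 + 2 * A₂ * e + A₄) := by
    have h : ((I.c₆ : ℤ) : ℚ) = ((-(A₂ + 3 * e) ^ 3 + 36 * (A₂ + 3 * e) * (3 * e ^ 2 + 2 * A₂ * e + A₄) : ℤ) : ℚ) := by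
      rw [hIc₆]; push_cast
      rw [hq, hc₄W₀] at h6'
      linear_combination h6' / 64
    exact_mod_cast h
  exact ⟨e, heZ, kummerBlindAtTwo_of_velu_half W₀ ha₁ ha₃ A₂ A₄ A₆ e hA₂ hA₄ hA₆ heZ I hc₄ hc₆⟩

/-- The same in the cell's vocabulary: **no doubling ∧ `Λ₁ ≠ Λ₀` ⟹ `W₀` is NOT free of blind rational `2`-torsion** — some rational root
is blind with integer witnesses. -/
theorem not_hasNonBlind_only_of_natAbs_eq_of_ne (D₁ : Gamma1ParametrizationData W₁ N)
    (D₀ : ModularParametrizationData W₀ N) (hiso : IsIsogenous W₁ W₀) (h₁ : D₁.IsOptimal)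
    (h₀ : ∀ z ∈ D₀.L.lattice, ∃ w ∈ periodLattice D₀.f, z = D₀.c * w) (h4 : 2 ^ 2 ∣ N)
    (ha₁ : W₀.a₁ = 0) (ha₃ : W₀.a₃ = 0) (A₂ A₄ A₆ : ℤ) (hA₂ : (A₂ : ℚ) = W₀.a₂) (hA₄ : (A₄ : ℚ) = W₀.a₄)
    (hA₆ : (A₆ : ℚ) = W₀.a₆) (heq : D₀.maninConstant.natAbs = D₁.maninConstant.natAbs)
    (hne : periodLatticeGamma1 D₀.f ≠ periodLattice D₀.f) :
    ∃ e : ℚ, e ^ 3 + W₀.a₂ * e ^ 2 + W₀.a₄ * e + W₀.a₆ = 0 ∧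
      ∃ A₂' A₄' E : ℤ, (A₂' : ℚ) = W₀.a₂ ∧ (A₄' : ℚ) = W₀.a₄ ∧ (E : ℚ) = e ∧ KummerBlindAtTwo A₂' A₄' E := by
  obtain ⟨e, he, hbl⟩ := exists_kummerBlind_root_of_natAbs_eq_of_ne D₁ D₀ hiso h₁ h₀ h4 ha₁ ha₃ A₂ A₄ A₆ hA₂ hA₄ hA₆ heq hne
  refine ⟨e, ?_, A₂, A₄, e, hA₂, hA₄, rfl, hbl⟩
  have h : ((e ^ 3 + A₂ * e ^ 2 + A₄ * e + A₆ : ℤ) : ℚ) = 0 := by exact_mod_cast he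
  push_cast at h
  rw [hA₂, hA₄, hA₆] at h
  exact h

/-- **CONTRAPOSITIVE — the doubled world is exactly the blind-free one.**  On a class at `4 ∣ N` with `Λ₁(f) ≠ Λ₀(f)` whose globally minimal
`W₀ = [0, a₂, 0, a₄, a₆]` has NO Kummer-blind integral `2`-division root, the optimal pair is DOUBLED: `|c₀| = 2|c₁|` (ledger
`|c₀| ∈ {|c₁|, 2|c₁|}`).  In particular `2 ∣ c₀` there — C2 can only hold on index-`2` classes WITH a blind rational root (E-an-152♭ is necessary).
[cite: Stevens1989, §2] [cite: LingOesterle1991, Thm. 6] -/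
theorem natAbs_eq_two_mul_of_noBlindRoot_of_ne (D₁ : Gamma1ParametrizationData W₁ N)
    (D₀ : ModularParametrizationData W₀ N) (hiso : IsIsogenous W₁ W₀) (h₁ : D₁.IsOptimal)
    (h₀ : ∀ z ∈ D₀.L.lattice, ∃ w ∈ periodLattice D₀.f, z = D₀.c * w) (h4 : 2 ^ 2 ∣ N)
    (ha₁ : W₀.a₁ = 0) (ha₃ : W₀.a₃ = 0) (A₂ A₄ A₆ : ℤ) (hA₂ : (A₂ : ℚ) = W₀.a₂) (hA₄ : (A₄ : ℚ) = W₀.a₄)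
    (hA₆ : (A₆ : ℚ) = W₀.a₆) (hno : ∀ e : ℤ, e ^ 3 + A₂ * e ^ 2 + A₄ * e + A₆ = 0 → ¬ KummerBlindAtTwo A₂ A₄ e)
    (hne : periodLatticeGamma1 D₀.f ≠ periodLattice D₀.f) :
    D₀.maninConstant.natAbs = 2 * D₁.maninConstant.natAbs := by
  rcases natAbs_maninConstant₀_eq_or_eq_two_mul_of_four_dvd_level D₁ D₀ hiso h₁ h₀ h4 with h | h
  · exfalso
    obtain ⟨e, he, hbl⟩ := exists_kummerBlind_root_of_natAbs_eq_of_ne D₁ D₀ hiso h₁ h₀ h4 ha₁ ha₃ A₂ A₄ A₆ hA₂ hA₄ hA₆ h hne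
    exact hno e he hbl
  · exact h

/-- … hence **`2 ∣ c₀` on a blind-free index-`2` class** (C2 FAILS in the blind-free doubled world). -/
theorem two_dvd_maninConstant₀_of_noBlindRoot_of_ne (D₁ : Gamma1ParametrizationData W₁ N)
    (D₀ : ModularParametrizationData W₀ N) (hiso : IsIsogenous W₁ W₀) (h₁ : D₁.IsOptimal)
    (h₀ : ∀ z ∈ D₀.L.lattice, ∃ w ∈ periodLattice D₀.f, z = D₀.c * w) (h4 : 2 ^ 2 ∣ N)
    (ha₁ : W₀.a₁ = 0) (ha₃ : W₀.a₃ = 0) (A₂ A₄ A₆ : ℤ) (hA₂ : (A₂ : ℚ) = W₀.a₂) (hA₄ : (A₄ : ℚ) = W₀.a₄)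
    (hA₆ : (A₆ : ℚ) = W₀.a₆) (hno : ∀ e : ℤ, e ^ 3 + A₂ * e ^ 2 + A₄ * e + A₆ = 0 → ¬ KummerBlindAtTwo A₂ A₄ e)
    (hne : periodLatticeGamma1 D₀.f ≠ periodLattice D₀.f) :
    (2 : ℤ) ∣ D₀.maninConstant := by
  have h := natAbs_eq_two_mul_of_noBlindRoot_of_ne D₁ D₀ hiso h₁ h₀ h4 ha₁ ha₃ A₂ A₄ A₆ hA₂ hA₄ hA₆ hno hne
  have h2 : (2 : ℤ) ∣ (D₀.maninConstant.natAbs : ℤ) := ⟨D₁.maninConstant.natAbs, by exact_mod_cast h⟩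
  exact Int.dvd_natAbs.mp h2

/-- **C2 forces a blind rational root on every index-`2` class** (`4 ∣ N`, `W₀ = [0,a₂,0,a₄,a₆]` globally minimal, `Λ₁(f) ≠ Λ₀(f)`):
`2 ∤ c₀ ⟹ ∃` a Kummer-blind integral `2`-division root.  (C2 ⟹ no doubling by the ledger `|c₀| ∈ {|c₁|, 2|c₁|}`, then §4.) -/
theorem exists_kummerBlind_root_of_not_two_dvd_of_ne (D₁ : Gamma1ParametrizationData W₁ N)
    (D₀ : ModularParametrizationData W₀ N) (hiso : IsIsogenous W₁ W₀) (h₁ : D₁.IsOptimal)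
    (h₀ : ∀ z ∈ D₀.L.lattice, ∃ w ∈ periodLattice D₀.f, z = D₀.c * w) (h4 : 2 ^ 2 ∣ N)
    (ha₁ : W₀.a₁ = 0) (ha₃ : W₀.a₃ = 0) (A₂ A₄ A₆ : ℤ) (hA₂ : (A₂ : ℚ) = W₀.a₂) (hA₄ : (A₄ : ℚ) = W₀.a₄)
    (hA₆ : (A₆ : ℚ) = W₀.a₆) (hodd : ¬ (2 : ℤ) ∣ D₀.maninConstant)
    (hne : periodLatticeGamma1 D₀.f ≠ periodLattice D₀.f) :
    ∃ e : ℤ, e ^ 3 + A₂ * e ^ 2 + A₄ * e + A₆ = 0 ∧ KummerBlindAtTwo A₂ A₄ e := by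
  refine exists_kummerBlind_root_of_natAbs_eq_of_ne D₁ D₀ hiso h₁ h₀ h4 ha₁ ha₃ A₂ A₄ A₆ hA₂ hA₄ hA₆ ?_ hne
  rcases natAbs_maninConstant₀_eq_or_eq_two_mul_of_four_dvd_level D₁ D₀ hiso h₁ h₀ h4 with h | h
  · exact h
  · exfalso
    exact hodd (Int.dvd_natAbs.mp ⟨D₁.maninConstant.natAbs, by exact_mod_cast h⟩)

end Summit.BirchSwinnertonDyer.BirchSwinnertonDyer.Theorems.ManinLocalTwoThree

end
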